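import Mathlib.MeasureTheory.Measure.Support
import Mathlib.MeasureTheory.Measure.Hausdorff
import Mathlib.Topology.MetricSpace.Thickening
import Literature.Analysis.FunctionSpaces.BesovDifference
import Literature.Analysis.FunctionSpaces.TorusFluidGlue
import Literature.Analysis.FluidPDE.DissipationAnomaly
import HarnessLib

/-!
# Barrier (AnomalousDissipation): intermittent (lower-dimensional) dissipation forces
sub-Kolmogorov regularity — the De Rosa–Isett vanishing-viscosity intermittency theorem
(D-0021 barrier catalogue for `Summits/AnomalousDissipation`; summit statement
`AnomalousDissipation := Literature.Turb.ZerothLaw`; seed barrier "intermittency corrections unknown")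

De Rosa–Isett, *Intermittency and lower dimensional dissipation in incompressible fluids*,
Arch. Ration. Mech. Anal. 248 (2024), Paper 11 (arXiv:2212.08176; theorem numbers below are
those of the arXiv version), Thm. 2.13 ("Eulerian vanishing viscosity intermittency"): let
`{v^ν}` be smooth solutions of the incompressible Navier–Stokes equations on `T^d × (0,T)` (or
`ℝ^d`) with `ν → 0`, enjoying the *interior* zeroth law
`liminf_{ν→0} ν ∫_δ^{T-δ} ∫ |∇v^ν|² dx dt > 0` for some `δ > 0` (op. cit. (2.22), the
reformulation of `liminf_{ν→0} ν∫₀ᵀ∫|∇v^ν|² > 0`, "which indeed might be seen as a precise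
mathematical formulation of the 0-th law of turbulence", op. cit. (1.3)), and such that the
dissipation measures converge, `ν|∇v^ν|² ⇀ μ` in `M⁺(T^d × [0,T])`. If the space–time support
`S = spt μ` has (upper) Minkowski dimension at most `γ + 1` — i.e.
`H^{d+1}((S)_{δ,δ}) ≲ δ^{d-γ}` for all small `δ`, `(S)_{δ,δ}` the space–time
`δ`-neighbourhood (op. cit. Def. 2.5 with `β = 1`, Rem. 2.6) — then for every `p ∈ [3,∞]` and
every `θ ∈ (0,1)` with `2θ/(1-θ) > 1 - (p-3)(d-γ)/p` one has
`lim_{ν→0} ‖v^ν‖_{L^p_t(B^θ_{p,∞})} = +∞`. For space-filling dissipation (`γ = d`) the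
threshold is Onsager's `θ = 1/3`; for `γ < d` it lies strictly below `1/3` for every `p > 3`
("energy dissipation that is lower-dimensional … implies deviations from the K41 prediction
`ζ_p = p/3` in every `p`-th order structure function for `p > 3`", op. cit. Abstract and
Thm. 1.1), and under the Lagrangian (Taylor-hypothesis) notion of dimension the excluded range
improves to `θ > θ_p = 1/3 - (d-γ)(p-3)/(3p)`, the `β`-model line
`ζ_p = p/3 - (3-D)(p-3)/3` of Frisch–Sulem–Nelkin (op. cit. Thm. 2.14 and (1.2)).

## What is vendored

* `DeRosaIsett2024_thm213` — Thm. 2.13 as printed, on the flat unit torus `T^d`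
  (`UnitAddTorus d`, any finite index type `d`; the `ℝ^d` case is omitted), with the accepted
  notions: smooth (classical) unforced Navier–Stokes solutions
  `Torus.IsClassicalNSSolutionOn (Ioo 0 T) ν 0 u p` (`Literature.Analysis.FunctionSpaces.TorusFluidGlue`;
  smooth on the open strip `(0,T) × T^d`, as printed — families that are not smooth at `t = 0`,
  e.g. with data merely compact in `L²`, are covered), the interior
  dissipation `Torus.cumulativeDissipation ν u δ (T-δ) = ν∫_δ^{T-δ}‖∇u‖₂²` (classical gradient,
  meaningful for smooth fields), the accepted dissipation-measure predicate
  `Torus.IsDissipationMeasureOf ν u T D` (`Literature.Analysis.FluidPDE.DissipationAnomaly`: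
  `ν_j|∇u_j|² dx dt ⇀ D` against bounded continuous functions on `[0,T] × T^d`, time first),
  Mathlib's `Measure.support` and `Metric.thickening` for `S = spt D` and `(S)_{δ,δ}` (the
  sup-metric neighbourhood on `ℝ × T^d`; it differs from the printed Euclidean one by constants
  only, which the hypothesis absorbs), and the accepted space–time Nikol'skii–Besov norm
  `eLpBesovSupNorm p θ p · volume (Ioo 0 T)` (`Literature.Analysis.FunctionSpaces.BesovDifference`).
  The family is a sequence `ν_j → 0`; `p ∈ [3,∞]` is an `ℝ≥0∞` exponent and the printed factor
  `(p-3)/p` is written `(1 - 3/p).toReal` (`= 1` at `p = ∞`, `= 0` at `p = 3`). The liminf in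
  the interior zeroth law is taken in `ℝ≥0∞` (no conditionally-complete junk).
  *Junk note.* `eLpBesovSupNorm` integrates `(‖u t‖_{B^θ_{p,∞}}).toReal`, which is `0` at a time
  slice of infinite Besov norm; on the class quantified over (fields smooth on `(0,T) × T^d`)
  every interior slice lies in every `B^θ_{p,∞}`, `θ ≤ 1` (accepted fact
  `Torus.IsSmooth.memBesovSup`), and `eLpBesovSupNorm … (Ioo 0 T)` only sees interior slices, so
  the convention is never triggered. *Binder names.* The paper's integrability exponent `p` is
  the binder `q : ℝ≥0∞` in the code (`p` denotes the pressure).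
* `DeRosaIsett2024_thm213.not_uniformlyBounded` — proved corollary, the barrier in the form in
  which it is used: under the hypotheses no bound `sup_j ‖u_j‖_{L^p_t B^θ_{p,∞}} ≤ M` can hold.
  `DeRosaIsett2024_thm213.onsager_threshold_of_homogeneous` — proved remark: the fact's
  condition `_hcond` specialised to `γ = d` reads `2θ/(1-θ) > 1`, i.e. `θ > 1/3`.
* The barrier docstring block sits on `DeRosaIsett2024_thm213`.
* (Barrier audit 2026-08-15.) `DeRosaIsett2024_thm213.measure_eq_zero_of_thickening_le`,
  `….volume_support_eq_zero`, `….interior_support_eq_empty`, `….isNowhereDense_support`,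
  `….card_le_of_pos_volume_support` — **proved**: the Minkowski hypothesis `_hdim` with `γ < d`
  forces the dissipation support to be Lebesgue-null and nowhere dense, so the theorem is silent on
  limiting dissipation with space-filling support (dense or multifractal carriers), for which only
  `γ = d` — Onsager's threshold — is available. `DeRosaDrivasInversiIsett2025_cor51` — the sequel
  of De Rosa–Drivas–Inversi–Isett (preprint dated 17 Feb 2025), Cor. 5.1 with Thm. 1.1(i) and
  Cor. 1.2: the same conclusion under the weaker hypothesis that the limiting dissipation is
  *concentrated* on an `H^s`-null space–time set (`μH[s] S = 0`, Mathlib's Hausdorff measure) with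
  `2σ/(1-σ) > 1 - (p-3)(d+1-s)/p`; vendored as a named fact for smooth solutions on `T^d` with
  the binders of `DeRosaIsett2024_thm213`, carrying its own barrier block (it covers dense
  concentration sets); **proved** from it: `….tendsto_top` (the printed "not uniformly bounded"
  upgraded to `lim = ∞` along the sequence, by subsequences) and `….of_support` (`S = spt D`).

## References

* L. De Rosa, P. Isett, Arch. Ration. Mech. Anal. 248 (2024), Paper No. 11; arXiv:2212.08176:
  Abstract, §1.1–1.3, (1.2)–(1.3), Def. 2.5, Rem. 2.6, Thm. 2.7, Def. 2.8, Thm. 2.9, §2.4 with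
  (2.22)–(2.23), Thm. 2.13, Thm. 2.14, Rem. 5.5, §6.1.
* U. Frisch, P.-L. Sulem, M. Nelkin, J. Fluid Mech. 87 (1978) 719–736 (the `β`-model).
* U. Frisch, *Turbulence* (CUP 1995), §6.1 (hypotheses H1–H3), §8.5 (`β`-model, bifractal and
  multifractal models; the Sulem–Frisch `k^{-8/3}` bound).
* P.-L. Sulem, U. Frisch, J. Fluid Mech. 72 (1975) 417–423.
* T. D. Drivas, G. L. Eyink, Nonlinearity 32 (2019), Thm. 1, Rem. 1 (the homogeneous,
  `γ = d`, singularity theorem for Leray solutions; vendored as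
  `Literature.Barriers.AnomalousDissipation.DrivasEyink2019_lemma1`).
* M. Novack, V. Vicol, Invent. Math. 233 (2023) 223–323 (intermittent Onsager theorem).
* E. Bruè, M. Colombo, G. Crippa, C. De Lellis, M. Sorella, Comm. Pure Appl. Anal. 23 (2024)
  (Onsager-critical forced Navier–Stokes solutions with anomalous dissipation).
* L. De Rosa, T. D. Drivas, M. Inversi, P. Isett, *Intermittency and dissipation regularity in
  turbulence*, preprint dated 17 Feb 2025 (read in full; Abstract, Thm. 1.1, Cor. 1.2,
  Prop. 1.3–1.4, §2.3–2.4, Prop. 3.1, proof of Cor. 1.2 in §3, Cor. 4.4, §5.1 with Cor. 5.1 and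
  (5.1), §5.2, §5.3). [DeRosaDrivasInversiIsett2025]
* P. Isett, Anal. PDE 17 (2024) 2123–2159 (arXiv:1706.01549), Prop. 3.2 (at the critical
  regularity `L^r_t B^{1/3}_{r,∞}`, `r > 3`, the dissipation measure is absolutely continuous).
* C. Meneveau, K. R. Sreenivasan, J. Fluid Mech. 224 (1991) 429–484, and U. Frisch, *Turbulence*
  (CUP 1995), §8.5.1, §8.6.1 with Fig. 8.17 (the measured dissipation is multifractal with a
  space-filling support; the `β`-model fits `ζ_p` only for `p ≲ 8`).
-/

open MeasureTheory Set Filter Topology Metric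
open scoped ENNReal NNReal

noncomputable section

namespace Literature.Barriers.AnomalousDissipation

/-- **De Rosa–Isett Eulerian vanishing-viscosity intermittency theorem** (De Rosa–Isett,
ARMA 248 (2024), Thm. 2.13 of arXiv:2212.08176). Let `d` be the dimension (`T^d`), `T > 0`,
`ν_j > 0` with `ν_j → 0`, and let `(u_j, p_j)` be smooth solutions of the (unforced)
incompressible Navier–Stokes equations with viscosity `ν_j` on the open strip `T^d × (0,T)`
(joint smoothness on `(0,T) × T^d`; nothing is assumed at `t = 0`) such that
(i) the interior zeroth law (2.22) holds: for some `δ > 0`,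
`liminf_j ν_j ∫_δ^{T-δ} ‖∇u_j(t)‖²_{L²} dt > 0`;
(ii) the dissipation measures converge: `ν_j|∇u_j|² dx dt ⇀ D` weakly as finite measures on
`[0,T] × T^d` (`Torus.IsDissipationMeasureOf`);
(iii) the support `S = spt D ⊆ ℝ × T^d` has space–time Minkowski dimension at most `γ + 1`,
`γ ∈ [0,d]`, in the sense of (2.8)/(2.13) with `β = 1`: there are `C` and `δ₀ > 0` with
`vol((S)_{δ,δ}) ≤ C δ^{d-γ}` for all `δ ∈ (0, δ₀)`, `(S)_{δ,δ}` the open space–time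
`δ`-neighbourhood of `S`.
Then for every `p ∈ [3,∞]` and every `θ ∈ (0,1)` with `2θ/(1-θ) > 1 - ((p-3)/p)(d-γ)`,
`lim_j ‖u_j‖_{L^p(0,T; B^θ_{p,∞}(T^d))} = +∞`.
(The paper's exponent `p ∈ [3,∞]` is the binder `q : ℝ≥0∞` below — `p` being the pressure —
and the factor `(p-3)/p` is `(1 - 3/q).toReal`, equal to `1` at `q = ∞` and `0` at `q = 3`.)

BARRIER (D-0021):
- technique_class: intermittent-witness-families closed-minkowski-thin-dissipation-support lower-dimensional-dissipation-support near-k41-uniform-besov-regularity beta-model-phenomenology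
- blocks: finite-window witness families for `Literature.Turb.ZerothLaw` = `AnomalousDissipation` read through the interior zeroth law `liminf_ν ν∫_δ^{T-δ}∫|∇v^ν|² > 0` ("a precise mathematical formulation of the 0-th law of turbulence" [cite: DeRosaIsett2024, §1.2 (1.3) and §2.4 (2.22)]) whose limiting dissipation is *intermittent* — supported on a space–time set of Minkowski dimension `≤ γ+1 < d+1` — while the velocities stay bounded in `L^p_t B^θ_{p,∞}` for some `p ∈ [3,∞]` and `θ` with `2θ/(1-θ) > 1 - (p-3)(d-γ)/p`: impossible, the norms must blow up [cite: DeRosaIsett2024, Thm. 2.13]; with the Lagrangian (Taylor-hypothesis) dimension the excluded range is `θ > θ_p = 1/3 - (d-γ)(p-3)/(3p)`, i.e. structure-function exponents of dissipating intermittent limits obey the `β`-model bound `ζ_p ≤ p/3 - (3-D)(p-3)/3` for `p ≥ 3` [cite: DeRosaIsett2024, Thm. 2.14 and (1.2)] [cite: FrischSulemNelkin1978]; so any scenario combining dissipation whose limiting measure has *closed, Minkowski-thin* support (`β`-model-like patchiness, with holes) with K41 regularity `B^{1/3-}_{p,∞}`, `p > 3`, uniformly in `ν`, is excluded [cite: DeRosaIsett2024,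 Abstract and Thm. 1.1–1.2]; (audit 2026-08-15) dissipation that is lower-dimensional only in the Hausdorff/concentration sense — dense or space-filling (multifractal) carriers — is outside this theorem ("the arguments … fail to give any non-trivial conclusion as soon as the dissipative set is anywhere dense") and is blocked, with the same exponent relation, by the sequel vendored below as `DeRosaDrivasInversiIsett2025_cor51` [cite: DeRosaDrivasInversiIsett2025, §1, Thm. 1.1, Cor. 1.2 and Cor. 5.1].
- because: a local variant of the Constantin–E–Titi argument: the Duchon–Robert distribution `D^v = lim_ε R_ε : ∇v_ε` of the limiting Euler flow is tested against a cut-off adapted to a cover of the dissipation support by `τ⁻¹δ^{-γ}` space–time cylinders, using a third-order (trilinear) commutator estimate and the double regularity of the pressure; the volume bound `H^{d+1}((S)_{δ,δ}) ≲ δ^{d-γ}` trades the dimension deficit `d-γ` against the regularity exponent, giving `D^v ≡ 0` when `2θ/(1-θ) > 1 - (p-3)(d-γ)/p` [cite: DeRosaIsett2024, §1 (proof outline), Thm. 2.7, §5.1]; the viscous statement follows by contradiction — a bounded subsequence is `L^p_{x,t}`-compact (Aubin–Lions–Simon), its limit is a weak Euler solution with `D^v = μ ≢ 0` by the interior zeroth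 law [cite: DeRosaIsett2024, §6.1].
- evasions_known: space-filling dissipation (`γ = d`): the threshold is then Onsager's `1/3` [cite: DeRosaIsett2024, §1.3], leaving room for dissipating families uniformly bounded in `L³_t C^{1/3-ε}_x`, which exist for the forced equations with `ν`-dependent forces [cite: BCCDS2024, Thm. 1.1] (`Literature.Analysis.FluidPDE.bccds_onsager_critical`); exponents `p < 3` are not constrained by the theorem, and non-conservative weak Euler flows in `C⁰_t(H^β ∩ L^{(2-2β)/(1-2β)})` for every `β < 1/2` ("`H^{1/2-} ∩ L^{∞-}`", i.e. `ζ_p = 1-` for all `p ≥ 2`, singular set indicated to be two-dimensional) exist [cite: NovackVicol2023, Thm. 1.1] [cite: DeRosaIsett2024, §1.3]; rapidly moving dissipation sets — lower-dimensional in each time slice but not coverable by the Lipschitz flow of a set of the same dimension — escape the Eulerian hypothesis [cite: DeRosaIsett2024, §2.3, Dichotomy after Thm. 2.7]; (audit 2026-08-15) supports of positive volume: the dimension hypothesis bears on the closed support `spt μ` in the upper-Minkowski sense ("every dense set automatically has full upper Minkowski dimension") [cite: DeRosaIsett2024, §3.1], and with `γ < d` it forces `spt μ` to be Lebesgue-null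 and nowhere dense (`DeRosaIsett2024_thm213.volume_support_eq_zero`, `….isNowhereDense_support`, proved below), so a limiting dissipation that is singular but has space-filling support — the multifractal picture indicated by experiment, "a nonsingular (`α = 1`) background of space-filling (`f(α) = 1`) dissipation" [cite: FrischTurbulence1995, §8.6.1 and Fig. 8.17] [cite: MeneveauSreenivasan1991], or Burgers-type shocks "proliferating over a dense set" [cite: DeRosaDrivasInversiIsett2025, §5.1] — meets `_hdim` only with `γ = d`, where the threshold is Onsager's `1/3` (`….onsager_threshold_of_homogeneous`); Hausdorff/Frostman notions of dimension were left to future work in print [cite: DeRosaIsett2024, §1.1] and are supplied, closing this evasion, by the concentration-set theorem vendored below as `DeRosaDrivasInversiIsett2025_cor51` [cite: DeRosaDrivasInversiIsett2025, Thm. 1.1 and Cor. 5.1].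
- scope_caveats: (a) printed for smooth solutions of the *unforced* Navier–Stokes equations on `T^d` or `ℝ^d` over a finite window with the interior condition (2.22) and converging dissipation measures; external forces (`f ∈ L^{p'}_{x,t}`) are incorporated only for the Euler-side criteria Thms. 2.7/2.9 [cite: DeRosaIsett2024, Rem. 5.5] and are not restated for Thm. 2.13 — the summit's steadily forced Leray–Hopf families, its `ν`-dependent data and its long-time `limsup` averages are not covered as printed; (b) the theorem constrains regularity only *relative to an assumed dimension bound* `γ` on the dissipation support: no theorem forces `γ < d` for vanishing-viscosity limits, and no theorem determines the exponents `ζ_p` — intermittency has "strong experimental foundations" but "adding mathematical rigor to describing this phenomenon still represents an important and challenging problem" [cite: DeRosaIsett2024, Abstract and §1.1]; unconditionally only one-sided Onsager-type bounds are known (`ζ_p ≤ p/3` for `p ≥ 3` along dissipating Leray families [cite: DrivasEyink2019, Rem. 1]; vanishing energy flux for spectra steeper than `k^{-8/3}` [cite: FrischTurbulence1995, §8.5.2] [cite: SulemFrisch1975]), and in the phenomenology (K41, `β`-model, multifractal) the finiteness and positivity of `ε` as `ν → 0` is hypothesis H3, assumed not derived [cite: FrischTurbulence1995, §6.1 and §8.5];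 (c) the sharper Lagrangian version needs `L²_{x,t}` convergence of the family, which "in general is not rigorously justified" [cite: DeRosaIsett2024, §1.2 and Thm. 2.14], and is not vendored here (Def. 2.8); (d) rendering: `T^d` only (the `ℝ^d` case is omitted), sup-metric space–time neighbourhoods (constants only), sequences `ν_j → 0`, theorem numbers of the arXiv version; (e) (audit 2026-08-15) in coverage this entry is superseded by `DeRosaDrivasInversiIsett2025_cor51` below (`H^s`-null concentration sets in place of Minkowski-thin supports; printed there also for Leray–Hopf weak solutions) and is retained as the refereed, purely geometric, support-based form; the implication `DeRosaDrivasInversiIsett2025_cor51 → DeRosaIsett2024_thm213` (a Minkowski bound `vol((spt D)_δ) ≲ δ^{d-γ}` makes `spt D` `H^s`-null for every `s > γ + 1`, upper Minkowski dimension dominating Hausdorff dimension [cite: DeRosaIsett2024, §3.1]) is not formalised here.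
- status: established (theorem) [cite: DeRosaIsett2024, Thm. 2.13]; coverage narrowed by the 2026-08-15 audit — see `DeRosaDrivasInversiIsett2025_cor51` -/
def DeRosaIsett2024_thm213 : Prop :=
  ∀ (d : Type) [Fintype d] [DecidableEq d] (T : ℝ) (_hT : 0 < T)
    (ν : ℕ → ℝ) (_hν : ∀ j, 0 < ν j) (_hν₀ : Tendsto ν atTop (𝓝 0))
    (u : ℕ → ℝ → UnitAddTorus d → EuclideanSpace ℝ d) (p : ℕ → ℝ → UnitAddTorus d → ℝ)
    (_hNS : ∀ j, Literature.Analysis.FunctionSpaces.Torus.IsClassicalNSSolutionOn (Ioo 0 T) (ν j) 0 (u j) (p j))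
    (_hzeroth : ∃ δ : ℝ, 0 < δ ∧
      0 < liminf (fun j => ENNReal.ofReal (Literature.Analysis.FunctionSpaces.Torus.cumulativeDissipation (ν j) (u j) δ (T - δ)))
        atTop)
    (D : Measure (ℝ × UnitAddTorus d)) (_hD : Literature.Analysis.FluidPDE.Torus.IsDissipationMeasureOf ν u T D)
    (γ : ℝ) (_hγ : 0 ≤ γ ∧ γ ≤ Fintype.card d)
    (_hdim : ∃ C : ℝ≥0∞, C ≠ ∞ ∧ ∃ δ₀ : ℝ, 0 < δ₀ ∧ ∀ δ ∈ Ioo 0 δ₀,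
      volume (thickening δ D.support) ≤ C * ENNReal.ofReal (δ ^ ((Fintype.card d : ℝ) - γ)))
    (q : ℝ≥0∞) (_hq : 3 ≤ q) (θ : ℝ) (_hθ : 0 < θ ∧ θ < 1)
    (_hcond : 1 - (1 - 3 / q).toReal * ((Fintype.card d : ℝ) - γ) < 2 * θ / (1 - θ)),
    Tendsto (fun j => Literature.Analysis.FunctionSpaces.eLpBesovSupNorm q θ q (u j) volume (Ioo 0 T)) atTop (𝓝 ∞)

/-- **Corollary (the barrier in the form used).** Under the hypotheses of
`DeRosaIsett2024_thm213` — smooth unforced Navier–Stokes solutions `u_j` on `T^d × (0,T)` with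
`ν_j → 0`, interior zeroth law, dissipation measures converging to `D` whose support has
space–time Minkowski dimension at most `γ + 1`, and `p ∈ [3,∞]`, `θ ∈ (0,1)` with
`2θ/(1-θ) > 1 - (p-3)(d-γ)/p` — the family is **not** uniformly bounded in
`L^p(0,T; B^θ_{p,∞}(T^d))`: there is no `M` with `‖u_j‖_{L^p_t B^θ_{p,∞}} ≤ M` for all `j`
(De Rosa–Isett 2024, Thm. 2.13, read contrapositively as in its proof, §6.1). Proved from
the named fact. [cite: DeRosaIsett2024, Thm. 2.13 and §6.1] -/
theorem DeRosaIsett2024_thm213.not_uniformlyBounded (h : DeRosaIsett2024_thm213)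
    (d : Type) [Fintype d] [DecidableEq d] (T : ℝ) (hT : 0 < T)
    (ν : ℕ → ℝ) (hν : ∀ j, 0 < ν j) (hν₀ : Tendsto ν atTop (𝓝 0))
    (u : ℕ → ℝ → UnitAddTorus d → EuclideanSpace ℝ d) (p : ℕ → ℝ → UnitAddTorus d → ℝ)
    (hNS : ∀ j, Literature.Analysis.FunctionSpaces.Torus.IsClassicalNSSolutionOn (Ioo 0 T) (ν j) 0 (u j) (p j))
    (hzeroth : ∃ δ : ℝ, 0 < δ ∧
      0 < liminf (fun j => ENNReal.ofReal (Literature.Analysis.FunctionSpaces.Torus.cumulativeDissipation (ν j) (u j) δ (T - δ)))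
        atTop)
    (D : Measure (ℝ × UnitAddTorus d)) (hD : Literature.Analysis.FluidPDE.Torus.IsDissipationMeasureOf ν u T D)
    (γ : ℝ) (hγ : 0 ≤ γ ∧ γ ≤ Fintype.card d)
    (hdim : ∃ C : ℝ≥0∞, C ≠ ∞ ∧ ∃ δ₀ : ℝ, 0 < δ₀ ∧ ∀ δ ∈ Ioo 0 δ₀,
      volume (thickening δ D.support) ≤ C * ENNReal.ofReal (δ ^ ((Fintype.card d : ℝ) - γ)))
    (q : ℝ≥0∞) (hq : 3 ≤ q) (θ : ℝ) (hθ : 0 < θ ∧ θ < 1)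
    (hcond : 1 - (1 - 3 / q).toReal * ((Fintype.card d : ℝ) - γ) < 2 * θ / (1 - θ)) :
    ¬ ∃ M : ℝ≥0, ∀ j, Literature.Analysis.FunctionSpaces.eLpBesovSupNorm q θ q (u j) volume (Ioo 0 T) ≤ M := by
  rintro ⟨M, hM⟩
  have ht := h d T hT ν hν hν₀ u p hNS hzeroth D hD γ hγ hdim q hq θ hθ hcond
  rw [ENNReal.tendsto_nhds_top_iff_nnreal] at ht
  obtain ⟨j, hj⟩ := (ht M).exists
  exact (lt_irrefl _) (hj.trans_le (hM j))

/-- **Remark (homogeneous case = Onsager threshold).** The hypothesis `_hcond` of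
`DeRosaIsett2024_thm213` — `1 - (1 - 3/q).toReal · (d - γ) < 2θ/(1-θ)`, with `d = n` the
dimension and `q` the integrability exponent — specialised to space-filling dissipation
`γ = d` reads `1 < 2θ/(1-θ)`, which for `θ ∈ (0,1)` is equivalent to `θ > 1/3`, whatever `q`:
"under the homogeneity assumption, i.e. when `γ = d`, the critical threshold … automatically
coincides with the K41 (and thus Onsager) prediction `θ = 1/3`" (De Rosa–Isett 2024, §1.3).
Elementary; proved here. [cite: DeRosaIsett2024, §1.3] -/
theorem DeRosaIsett2024_thm213.onsager_threshold_of_homogeneous (n : ℕ) (q : ℝ≥0∞)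
    {γ θ : ℝ} (hγ : γ = n) (hθ : 0 < θ ∧ θ < 1) :
    (1 - (1 - 3 / q).toReal * ((n : ℝ) - γ) < 2 * θ / (1 - θ)) ↔ 1 / 3 < θ := by
  subst hγ
  have h1 : 0 < 1 - θ := by linarith [hθ.2]
  rw [sub_self, mul_zero, sub_zero, lt_div_iff₀ h1]
  constructor <;> intro h <;> linarith

/-! ### Barrier audit 2026-08-15 (D-0021): what the Minkowski hypothesis forces, and the
Hausdorff-dimension sequel of De Rosa–Drivas–Inversi–Isett (2025)

The dimension hypothesis `_hdim` of `DeRosaIsett2024_thm213` is a bound on the volume of the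
thickenings of the *closed support* of the limiting dissipation. With `γ < d` it forces that
support to be Lebesgue-null and nowhere dense (proved below), so the theorem says nothing about
limiting dissipation measures that are singular but have space-filling support — for those only
`γ = d` is available and the threshold is Onsager's `1/3`
(`DeRosaIsett2024_thm213.onsager_threshold_of_homogeneous`). The sequel of
De Rosa–Drivas–Inversi–Isett replaces the Minkowski dimension of the support by the Hausdorff
dimension of a *concentration set*, with the same exponent relation; it is vendored below as
`DeRosaDrivasInversiIsett2025_cor51`. -/

/-- **A set whose `δ`-thickenings have measure `O(δ^e)`, `e > 0`, is null.** If
`μ((S)_δ) ≤ C δ^e` for all `δ ∈ (0, δ₀)` with `C < ∞` and `e > 0`, then `μ(S) = 0`, since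
`S ⊆ (S)_δ` for every `δ > 0` and `C δ^e → 0`. This is the shape of the Minkowski hypothesis
`_hdim` of `DeRosaIsett2024_thm213` (exponent `e = d - γ`). [folklore] -/
theorem DeRosaIsett2024_thm213.measure_eq_zero_of_thickening_le {X : Type*}
    [PseudoEMetricSpace X] [MeasurableSpace X] (μ : Measure X) (S : Set X) {e : ℝ} (he : 0 < e)
    (h : ∃ C : ℝ≥0∞, C ≠ ∞ ∧ ∃ δ₀ : ℝ, 0 < δ₀ ∧ ∀ δ ∈ Ioo 0 δ₀,
      μ (thickening δ S) ≤ C * ENNReal.ofReal (δ ^ e)) :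
    μ S = 0 := by
  obtain ⟨C, hC, δ₀, hδ₀, hb⟩ := h
  have ht : Tendsto (fun δ : ℝ => C * ENNReal.ofReal (δ ^ e)) (𝓝[>] 0) (𝓝 0) := by
    have h1 : Tendsto (fun δ : ℝ => δ ^ e) (𝓝[>] 0) (𝓝 0) := by
      have := (Real.continuousAt_rpow_const 0 e (Or.inr he.le)).tendsto
      rw [Real.zero_rpow he.ne'] at this
      exact this.mono_left nhdsWithin_le_nhds
    have h2 : Tendsto (fun δ : ℝ => ENNReal.ofReal (δ ^ e)) (𝓝[>] 0) (𝓝 0) := by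
      have := (ENNReal.continuous_ofReal.tendsto 0).comp h1
      simpa [Function.comp_def] using this
    simpa using ENNReal.Tendsto.const_mul h2 (Or.inr hC)
  have hev : ∀ᶠ δ in 𝓝[>] (0 : ℝ), μ S ≤ C * ENNReal.ofReal (δ ^ e) := by
    filter_upwards [Ioo_mem_nhdsGT hδ₀] with δ hδ
    exact (measure_mono (self_subset_thickening hδ.1 S)).trans (hb δ hδ)
  exact le_antisymm (ge_of_tendsto ht hev) bot_le

/-- **The Minkowski hypothesis of `DeRosaIsett2024_thm213` with `γ < d` makes the dissipation
support Lebesgue-null.** If `vol((spt D)_δ) ≤ C δ^{d-γ}` for small `δ` and `γ < d`, then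
`vol(spt D) = 0` in `ℝ × T^d`: the barrier constrains only limiting dissipation measures that
are singular with a Lebesgue-null closed support ("every dense set automatically has full upper
Minkowski dimension", De Rosa–Isett 2024, §3.1; "the arguments … fail to give any non-trivial
conclusion as soon as the dissipative set is anywhere dense", De Rosa–Drivas–Inversi–Isett 2025,
§1). [cite: DeRosaIsett2024, §3.1] -/
theorem DeRosaIsett2024_thm213.volume_support_eq_zero {d : Type} [Fintype d]
    (D : Measure (ℝ × UnitAddTorus d)) {γ : ℝ} (hγ : γ < Fintype.card d)
    (hdim : ∃ C : ℝ≥0∞, C ≠ ∞ ∧ ∃ δ₀ : ℝ, 0 < δ₀ ∧ ∀ δ ∈ Ioo 0 δ₀,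
      volume (thickening δ D.support) ≤ C * ENNReal.ofReal (δ ^ ((Fintype.card d : ℝ) - γ))) :
    volume D.support = 0 :=
  DeRosaIsett2024_thm213.measure_eq_zero_of_thickening_le volume D.support (sub_pos.2 hγ) hdim

/-- **… hence the dissipation support has empty interior** (open sets of `ℝ × T^d` have positive
volume). In particular a limiting dissipation whose support contains an open space–time set — a
fortiori one with space-filling support — admits the hypothesis `_hdim` of
`DeRosaIsett2024_thm213` for no `γ < d`. [cite: DeRosaIsett2024, §3.1] -/
theorem DeRosaIsett2024_thm213.interior_support_eq_empty {d : Type} [Fintype d]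
    (D : Measure (ℝ × UnitAddTorus d)) {γ : ℝ} (hγ : γ < Fintype.card d)
    (hdim : ∃ C : ℝ≥0∞, C ≠ ∞ ∧ ∃ δ₀ : ℝ, 0 < δ₀ ∧ ∀ δ ∈ Ioo 0 δ₀,
      volume (thickening δ D.support) ≤ C * ENNReal.ofReal (δ ^ ((Fintype.card d : ℝ) - γ))) :
    interior D.support = ∅ := by
  by_contra hne
  have hpos := isOpen_interior.measure_pos (volume : Measure (ℝ × UnitAddTorus d))
    (Set.nonempty_iff_ne_empty.2 hne)
  exact hpos.ne' (measure_mono_null interior_subset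
    (DeRosaIsett2024_thm213.volume_support_eq_zero D hγ hdim))

/-- **… i.e. the (closed) dissipation support is nowhere dense**: the barrier
`DeRosaIsett2024_thm213` bites only on `β`-model-like supports "with holes", never on dense ones
(Mathlib: `Measure.isClosed_support`, `IsClosed.isNowhereDense_iff`). [cite: DeRosaIsett2024, §3.1] -/
theorem DeRosaIsett2024_thm213.isNowhereDense_support {d : Type} [Fintype d]
    (D : Measure (ℝ × UnitAddTorus d)) {γ : ℝ} (hγ : γ < Fintype.card d)
    (hdim : ∃ C : ℝ≥0∞, C ≠ ∞ ∧ ∃ δ₀ : ℝ, 0 < δ₀ ∧ ∀ δ ∈ Ioo 0 δ₀,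
      volume (thickening δ D.support) ≤ C * ENNReal.ofReal (δ ^ ((Fintype.card d : ℝ) - γ))) :
    IsNowhereDense D.support :=
  (Measure.isClosed_support (μ := D)).isNowhereDense_iff.2
    (DeRosaIsett2024_thm213.interior_support_eq_empty D hγ hdim)

/-- **Contrapositive: a dissipation support of positive volume admits the Minkowski hypothesis
only with `γ ≥ d`**, where the condition `_hcond` of `DeRosaIsett2024_thm213` is Onsager's
`θ > 1/3` (`….onsager_threshold_of_homogeneous`). [cite: DeRosaIsett2024, §1.3 and §3.1] -/
theorem DeRosaIsett2024_thm213.card_le_of_pos_volume_support {d : Type} [Fintype d]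
    (D : Measure (ℝ × UnitAddTorus d)) (hpos : 0 < volume D.support) {γ : ℝ}
    (hdim : ∃ C : ℝ≥0∞, C ≠ ∞ ∧ ∃ δ₀ : ℝ, 0 < δ₀ ∧ ∀ δ ∈ Ioo 0 δ₀,
      volume (thickening δ D.support) ≤ C * ENNReal.ofReal (δ ^ ((Fintype.card d : ℝ) - γ))) :
    (Fintype.card d : ℝ) ≤ γ :=
  not_lt.1 fun h => hpos.ne' (DeRosaIsett2024_thm213.volume_support_eq_zero D h hdim)

/-- **De Rosa–Drivas–Inversi–Isett: vanishing-viscosity intermittency from Hausdorff-null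
concentration of the dissipation** (L. De Rosa, T. D. Drivas, M. Inversi, P. Isett,
*Intermittency and dissipation regularity in turbulence*, preprint dated 17 Feb 2025: Cor. 5.1
with Thm. 1.1(i) and Cor. 1.2, numbering of that version). Printed, Cor. 5.1 (`T³ × (0,T)`; "the
result is true in any spatial dimension `d ≥ 2`", §5.1): let `{u^ν} ⊂ L²_t H¹_x` be weak
solutions of (NS) whose total dissipations `ℰ^ν = D^ν + ν|∇u^ν|²` converge in `𝒟'_{x,t}` to a
non-trivial measure concentrated on a set `S` with `dim_H S = γ`; if `{u^ν}` stays bounded in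
`L^p_t B^{ζ_p/p}_{p,∞}`, `p ∈ [3,∞]`, then `ζ_p ≤ p/3 - 2κ(p-3)p/(9p - 3κ(p-3))`, `κ = 4 - γ`;
in any `d` this is (1.3) of Cor. 1.2, `2σ_p/(1-σ_p) ≤ 1 - ((p-3)/p)(d+1-γ)`, whose proof runs
through `H^{γ̃}(S) = 0` for a `γ̃ > γ` keeping the strict inequality and Thm. 1.1(i),
`|D| ≪ H^{γ̃}`. Vendored contrapositively, with the binders of `DeRosaIsett2024_thm213`: `d ≥ 2`,
`T > 0`, `ν_j > 0`, `ν_j → 0`, smooth unforced Navier–Stokes solutions `(u_j, p_j)` on the open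
strip `T^d × (0,T)` (so `D^ν ≡ 0` and `ℰ^ν = ν_j|∇u_j|²`), the interior zeroth law (2.22) of
De Rosa–Isett and `ν_j|∇u_j|² dx dt ⇀ D` (`Torus.IsDissipationMeasureOf`) — which together give
`𝒟'`-convergence on the open slab to a measure that is non-trivial there —, a set `S ⊆ ℝ × T^d`
carrying `D` inside the slab, `D(((0,T) × T^d) ∖ S) = 0`, of `s`-dimensional Hausdorff measure
zero, `μH[s] S = 0` with `s ≥ 0` (Mathlib's Hausdorff measure for the sup metric of `ℝ × T^d`,
bi-Lipschitz to the Euclidean one and so with the same null sets), and `p ∈ [3,∞]` (the binder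
`q`; `p` is the pressure), `σ ∈ (0,1)` with `2σ/(1-σ) > 1 - ((p-3)/p)(d+1-s)`, written
`1 - (1 - 3/q).toReal·(d+1-s) < 2σ/(1-σ)`. Conclusion: the family is **not** bounded in
`L^p(0,T; B^σ_{p,∞}(T^d))` (the upgrade to `lim_j = ∞`, by subsequences, is `….tendsto_top`).
With `S = spt D` (`….of_support`) and `s ↓ γ + 1` this contains the situation of
`DeRosaIsett2024_thm213`, a Minkowski bound `vol((spt D)_δ) ≲ δ^{d-γ}` making `spt D` `H^s`-null
for all `s > γ + 1`; the point of the Hausdorff form is that `S` may be dense ("the use of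
Hausdorff to measure the dimension allows to deduce intermittency even if the concentration set
happens to be locally dense", op. cit. §5.1; the paper "closes the gap and finally reconciles"
the Minkowski approach of De Rosa–Isett with the Hausdorff approach of De Rosa–Drivas–Inversi,
§5.3).

BARRIER (D-0021):
- technique_class: intermittent-witness-families hausdorff-null-dissipation-concentration-sets dense-or-multifractal-dissipation-carriers lower-dimensional-dissipation-support near-k41-uniform-besov-regularity beta-model-multifractal-phenomenology
- blocks: finite-window witness families for `Literature.Turb.ZerothLaw` = `AnomalousDissipation` (read through the interior zeroth law `liminf_ν ν∫_δ^{T-δ}∫|∇v^ν|² > 0` and converging dissipation measures `ν|∇v^ν|² ⇀ D`, as for `DeRosaIsett2024_thm213`) whose limiting dissipation is carried, inside the window, by a space–time set `S` with `H^s(S) = 0` while the velocities stay bounded in `L^p_t B^σ_{p,∞}` for some `p ∈ [3,∞]`, `σ ∈ (0,1)` with `2σ/(1-σ) > 1 - (p-3)(d+1-s)/p`: impossible [cite: DeRosaDrivasInversiIsett2025, Cor. 5.1, Cor. 1.2 and Thm. 1.1]; in structure-function terms, bounded families obey `ζ_p ≤ p/3 - 2κ(p-3)p/(9p-3κ(p-3))`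 with `κ = d + 1 - dim_H S`, a strict downward deviation from `p/3` for every `p > 3` as soon as `κ > 0` [cite: DeRosaDrivasInversiIsett2025, §5.1 with (5.1)]; unlike `DeRosaIsett2024_thm213` the carrier `S` may be dense, even space-filling in closure, so singular "multifractal" dissipation charging only a set of Hausdorff dimension `< d + 1` is covered ("the use of Hausdorff to measure the dimension allows to deduce intermittency even if the concentration set happens to be locally dense") [cite: DeRosaDrivasInversiIsett2025, §1 and §5.1]; hence K41 regularity `B^{1/3-}_{p,∞}`, `p > 3`, uniformly in `ν`, is incompatible with every limiting dissipation that gives zero mass outside some `H^s`-null set with `s < d + 1`.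
- because: the modified local energy identity `-D = (∂ₜ + u_ℓ·∇)E^ℓ + div Q^ℓ + C^ℓ`, `E^ℓ = ½|u-u_ℓ|²`, `Q^ℓ = (½|u-u_ℓ|² + q - q_ℓ)(u-u_ℓ)`, `C^ℓ = (u-u_ℓ)·div R^ℓ + (u-u_ℓ)⊗(u-u_ℓ):∇u_ℓ`, valid for every `ℓ > 0` (and with viscous terms for Navier–Stokes) [cite: DeRosaDrivasInversiIsett2025, Prop. 1.3 and Prop. 3.1], with `‖E^ℓ‖_{L^{p/2}} ≲ ℓ^{2σ}`, `‖Q^ℓ‖_{L^{p/3}} ≲ ℓ^{3σ}`, `‖C^ℓ‖_{L^{p/3}} ≲ ℓ^{3σ-1}` (using the double regularity of the pressure) [cite: DeRosaDrivasInversiIsett2025, Cor. 2.2 and (2.6)], yields the mollification rates `|⟨D - D∗ρ_δ, φ⟩| ≲ δ^{2σ/(1-σ)}‖φ‖_{W^{1,p/(p-3)}}` and `|⟨D∗ρ_δ, φ⟩| ≲ δ^{2σ/(1-σ)-1}‖φ‖_{L^{p/(p-3)}}` [cite: DeRosaDrivasInversiIsett2025, Prop. 1.4], hence `D ∈ B^{2σ/(1-σ)-1}_{p/3,∞}`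 locally and, for `D ≥ 0`, the uniform ball estimate `D(B_r(x,t)) ≲ r^{2σ/(1-σ) - 1 + (p-3)(d+1)/p}`, from which `|D| ≪ H^γ` whenever `2σ/(1-σ) > 1 - (p-3)(d+1-γ)/p` [cite: DeRosaDrivasInversiIsett2025, Thm. 1.1 and §3]; a non-trivial measure concentrated on an `H^γ`-null set then cannot arise, and the viscous statement follows by contradiction as in De Rosa–Isett §6.1 (a bounded subsequence is strongly compact by Aubin–Lions–Simon, its limit is a weak Euler solution in `L^p_t B^σ_{p,∞}` whose Duchon–Robert measure is the `𝒟'`-limit of `ℰ^ν`) [cite: DeRosaDrivasInversiIsett2025, §5.1] [cite: DeRosaIsett2024, §6.1].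
- evasions_known: carriers of full dimension (`s = d + 1`: e.g. dissipation with an absolutely continuous part) reduce the condition to Onsager's `σ > 1/3`, so dissipating families bounded in `B^{1/3-}_{p,∞}` with space–time-filling dissipation are untouched [cite: DeRosaDrivasInversiIsett2025, Cor. 1.2 and §5.1] — while at exactly critical regularity `L^r_t B^{1/3}_{r,∞}`, `r > 3`, the dissipation measure of a weak Euler solution is even absolutely continuous, `D ∈ L^{r/3}_{t,x}` [cite: Isett2024Endpoint, Prop. 3.2]; `p = 3`: "for `p = 3` lower dimensionality does not give any correction, which is consistent with the Kolmogorov Four-Fifths law being exact", so `L³`-based regularity `B^{1/3-}_{3,∞}` is never constrained below Onsager, and `p < 3` lies outside the theorem [cite: DeRosaDrivasInversiIsett2025, §5.1]; dissipation escaping to the time boundary (all mass at `t = T`, as in the forced constructions) is invisible to the interior statement [cite: DeRosaIsett2024, §2.4] [cite: BCCDS2024, Thm. 1.1]; sharpness is open — "producing weak solutions of (E) with a non-trivial lower dimensional non-negative measure `D` is not yet done", only the negative Besov regularity of `D` being known optimal (at `p = ∞`, through prescribed Cantor-type energy profiles) [cite: DeRosaDrivasInversiIsett2025, §5.3].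
- scope_caveats: (a) numbering and wording of the preprint dated 17 Feb 2025 (unrefereed at audit time); Thm. 1.1 and Cor. 1.2 are proved in its §3, Cor. 5.1 is stated as their "direct consequence", the Navier–Stokes passage being that of De Rosa–Isett §6.1 [cite: DeRosaDrivasInversiIsett2025, §5.1] [cite: DeRosaIsett2024, §6.1]; (b) printed for weak solutions `u^ν ∈ L²_t H¹_x` with suitable (Leray–Hopf) defects `D^ν ≥ 0`, `ℰ^ν = D^ν + ν|∇u^ν|²`, on `T³` ("true in any `d ≥ 2`"); vendored only for smooth unforced solutions on `T^d` (`D^ν ≡ 0`), sequences `ν_j → 0`, weak-* convergence of the dissipation measures on the closed slab plus the interior zeroth law (2.22) in place of "`ℰ^ν →` a non-trivial measure in `𝒟'`" (they imply it), and Mathlib's `μH[s]` for the sup metric; (c) external forces, long-time `limsup` averages and steady `ν`-independent forcing — the summit's setting — are not treated in print (the Euler-side estimates absorb forces `f ∈ L^{p'}_{x,t}` [cite: DeRosaIsett2024, Rem. 5.5]; the rest is unstated), so, like `DeRosaIsett2024_thm213`, this entry constrains the summit's steadily forced Leray–Hopf families only by analogy; (d) it constrains regularity relative to an *assumed* dimension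 bound on a carrier of the limiting dissipation: nothing forces `s < d + 1`, and "a quantitative theoretical understanding of intermittency from first principles is still missing" [cite: DeRosaDrivasInversiIsett2025, §5.1]; (e) the implication to `DeRosaIsett2024_thm213` (a Minkowski-thin support is `H^s`-null for `s > γ + 1` [cite: DeRosaIsett2024, §3.1]; cf. the Minkowski corollary [cite: DeRosaDrivasInversiIsett2025, Cor. 4.4]) is not formalised here.
- status: established — theorem with complete printed proof in a 2025 preprint (unrefereed at audit time) [cite: DeRosaDrivasInversiIsett2025, Thm. 1.1, Cor. 1.2 and Cor. 5.1] -/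
def DeRosaDrivasInversiIsett2025_cor51 : Prop :=
  ∀ (d : Type) [Fintype d] [DecidableEq d] (_hd : 2 ≤ Fintype.card d) (T : ℝ) (_hT : 0 < T)
    (ν : ℕ → ℝ) (_hν : ∀ j, 0 < ν j) (_hν₀ : Tendsto ν atTop (𝓝 0))
    (u : ℕ → ℝ → UnitAddTorus d → EuclideanSpace ℝ d) (p : ℕ → ℝ → UnitAddTorus d → ℝ)
    (_hNS : ∀ j, Literature.Analysis.FunctionSpaces.Torus.IsClassicalNSSolutionOn (Ioo 0 T) (ν j) 0 (u j) (p j))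
    (_hzeroth : ∃ δ : ℝ, 0 < δ ∧
      0 < liminf (fun j => ENNReal.ofReal (Literature.Analysis.FunctionSpaces.Torus.cumulativeDissipation (ν j) (u j) δ (T - δ)))
        atTop)
    (D : Measure (ℝ × UnitAddTorus d)) (_hD : Literature.Analysis.FluidPDE.Torus.IsDissipationMeasureOf ν u T D)
    (S : Set (ℝ × UnitAddTorus d)) (_hconc : D ((Ioo 0 T ×ˢ univ) \ S) = 0)
    (s : ℝ) (_hs : 0 ≤ s) (_hH : μH[s] S = 0)
    (q : ℝ≥0∞) (_hq : 3 ≤ q) (σ : ℝ) (_hσ : 0 < σ ∧ σ < 1)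
    (_hcond : 1 - (1 - 3 / q).toReal * ((Fintype.card d : ℝ) + 1 - s) < 2 * σ / (1 - σ)),
    ¬ ∃ M : ℝ≥0, ∀ j, Literature.Analysis.FunctionSpaces.eLpBesovSupNorm q σ q (u j) volume (Ioo 0 T) ≤ M

namespace DeRosaDrivasInversiIsett2025

/-- A dissipation measure of a sequence is a dissipation measure of each of its subsequences
(the weak gradients and the weak convergence pass to subsequences; the same five lines as
`DeRosaIsett2024.isDissipationMeasureOf_comp` of the Proofs file, which cannot be imported
here). [folklore] -/
theorem isDissipationMeasureOf_subseq {d : Type} [Fintype d] [DecidableEq d] {ν : ℕ → ℝ}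
    {u : ℕ → ℝ → UnitAddTorus d → EuclideanSpace ℝ d} {T : ℝ} {D : Measure (ℝ × UnitAddTorus d)}
    (h : Literature.Analysis.FluidPDE.Torus.IsDissipationMeasureOf ν u T D) {φ : ℕ → ℕ}
    (hφ : StrictMono φ) :
    Literature.Analysis.FluidPDE.Torus.IsDissipationMeasureOf (ν ∘ φ) (u ∘ φ) T D := by
  obtain ⟨G, h1, h2, h3, h4, h5⟩ := h
  exact ⟨G ∘ φ, fun m => h1 (φ m), fun m => h2 (φ m), fun m => h3 (φ m), h4,
    fun g => (h5 g).comp hφ.tendsto_atTop⟩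

/-- The `liminf` along a subsequence dominates the `liminf` along the sequence (in `ℝ≥0∞`), so
the interior zeroth law passes to subsequences. [folklore] -/
theorem liminf_le_liminf_subseq {f : ℕ → ℝ≥0∞} {φ : ℕ → ℕ} (hφ : StrictMono φ) :
    liminf f atTop ≤ liminf (f ∘ φ) atTop := by
  rw [liminf_comp]
  exact liminf_le_liminf_of_le hφ.tendsto_atTop

end DeRosaDrivasInversiIsett2025

/-- **Upgrade to `lim = ∞`.** Under `DeRosaDrivasInversiIsett2025_cor51`, in its situation the
norms `‖u_j‖_{L^p_t B^σ_{p,∞}}` tend to `+∞` along the whole sequence (not merely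
`sup_j = ∞`): otherwise some subsequence is bounded, and a subsequence of the family satisfies
every hypothesis again (`ν_{φ(k)} → 0`, the interior zeroth law by monotonicity of `liminf`
under subsequences, the same dissipation measure `D` by
`DeRosaDrivasInversiIsett2025.isDissipationMeasureOf_subseq`, the same `S`, `s`) — the form
`lim_{ν→0} ‖v^ν‖ = +∞` in which De Rosa–Isett state their Thm. 2.13. Proved from the named
fact. [cite: DeRosaDrivasInversiIsett2025, Cor. 5.1] [cite: DeRosaIsett2024, Thm. 2.13] -/
theorem DeRosaDrivasInversiIsett2025_cor51.tendsto_top (h : DeRosaDrivasInversiIsett2025_cor51)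
    (d : Type) [Fintype d] [DecidableEq d] (hd : 2 ≤ Fintype.card d) (T : ℝ) (hT : 0 < T)
    (ν : ℕ → ℝ) (hν : ∀ j, 0 < ν j) (hν₀ : Tendsto ν atTop (𝓝 0))
    (u : ℕ → ℝ → UnitAddTorus d → EuclideanSpace ℝ d) (p : ℕ → ℝ → UnitAddTorus d → ℝ)
    (hNS : ∀ j, Literature.Analysis.FunctionSpaces.Torus.IsClassicalNSSolutionOn (Ioo 0 T) (ν j) 0 (u j) (p j))
    (hzeroth : ∃ δ : ℝ, 0 < δ ∧
      0 < liminf (fun j => ENNReal.ofReal (Literature.Analysis.FunctionSpaces.Torus.cumulativeDissipation (ν j) (u j) δ (T - δ)))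
        atTop)
    (D : Measure (ℝ × UnitAddTorus d)) (hD : Literature.Analysis.FluidPDE.Torus.IsDissipationMeasureOf ν u T D)
    (S : Set (ℝ × UnitAddTorus d)) (hconc : D ((Ioo 0 T ×ˢ univ) \ S) = 0)
    (s : ℝ) (hs : 0 ≤ s) (hH : μH[s] S = 0)
    (q : ℝ≥0∞) (hq : 3 ≤ q) (σ : ℝ) (hσ : 0 < σ ∧ σ < 1)
    (hcond : 1 - (1 - 3 / q).toReal * ((Fintype.card d : ℝ) + 1 - s) < 2 * σ / (1 - σ)) :
    Tendsto (fun j => Literature.Analysis.FunctionSpaces.eLpBesovSupNorm q σ q (u j) volume (Ioo 0 T))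
      atTop (𝓝 ∞) := by
  by_contra hnot
  rw [ENNReal.tendsto_nhds_top_iff_nnreal] at hnot
  obtain ⟨M, hM⟩ := not_forall.1 hnot
  have hfreq : ∃ᶠ j in atTop,
      Literature.Analysis.FunctionSpaces.eLpBesovSupNorm q σ q (u j) volume (Ioo 0 T) ≤ M :=
    (Filter.not_eventually.1 hM).mono fun j hj => not_lt.1 hj
  obtain ⟨φ, hφ, hφM⟩ := Filter.extraction_of_frequently_atTop hfreq
  refine h d hd T hT (ν ∘ φ) (fun k => hν (φ k)) (hν₀.comp hφ.tendsto_atTop) (u ∘ φ) (p ∘ φ)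
    (fun k => hNS (φ k)) ?_ D (DeRosaDrivasInversiIsett2025.isDissipationMeasureOf_subseq hD hφ)
    S hconc s hs hH q hq σ hσ hcond ⟨M, fun k => hφM k⟩
  obtain ⟨δ, hδ, hlim⟩ := hzeroth
  exact ⟨δ, hδ, hlim.trans_le (DeRosaDrivasInversiIsett2025.liminf_le_liminf_subseq hφ)⟩

/-- **The support form.** Under `DeRosaDrivasInversiIsett2025_cor51`: if the closed support of
the limiting dissipation measure is `H^s`-null, `μH[s] (spt D) = 0`, with
`2σ/(1-σ) > 1 - (p-3)(d+1-s)/p`, the family is not bounded in `L^p_t B^σ_{p,∞}` — `D` is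
carried by its support (`Measure.measure_compl_support`, `ℝ × T^d` being second countable).
This is the meeting point with `DeRosaIsett2024_thm213`, whose Minkowski hypothesis makes
`spt D` `H^s`-null for every `s > γ + 1` (De Rosa–Isett 2024, §3.1; not formalised). Proved from
the named fact. [cite: DeRosaDrivasInversiIsett2025, Cor. 5.1 and Cor. 4.4] -/
theorem DeRosaDrivasInversiIsett2025_cor51.of_support (h : DeRosaDrivasInversiIsett2025_cor51)
    (d : Type) [Fintype d] [DecidableEq d] (hd : 2 ≤ Fintype.card d) (T : ℝ) (hT : 0 < T)
    (ν : ℕ → ℝ) (hν : ∀ j, 0 < ν j) (hν₀ : Tendsto ν atTop (𝓝 0))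
    (u : ℕ → ℝ → UnitAddTorus d → EuclideanSpace ℝ d) (p : ℕ → ℝ → UnitAddTorus d → ℝ)
    (hNS : ∀ j, Literature.Analysis.FunctionSpaces.Torus.IsClassicalNSSolutionOn (Ioo 0 T) (ν j) 0 (u j) (p j))
    (hzeroth : ∃ δ : ℝ, 0 < δ ∧
      0 < liminf (fun j => ENNReal.ofReal (Literature.Analysis.FunctionSpaces.Torus.cumulativeDissipation (ν j) (u j) δ (T - δ)))
        atTop)
    (D : Measure (ℝ × UnitAddTorus d)) (hD : Literature.Analysis.FluidPDE.Torus.IsDissipationMeasureOf ν u T D)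
    (s : ℝ) (hs : 0 ≤ s) (hH : μH[s] D.support = 0)
    (q : ℝ≥0∞) (hq : 3 ≤ q) (σ : ℝ) (hσ : 0 < σ ∧ σ < 1)
    (hcond : 1 - (1 - 3 / q).toReal * ((Fintype.card d : ℝ) + 1 - s) < 2 * σ / (1 - σ)) :
    ¬ ∃ M : ℝ≥0, ∀ j, Literature.Analysis.FunctionSpaces.eLpBesovSupNorm q σ q (u j) volume (Ioo 0 T) ≤ M :=
  h d hd T hT ν hν hν₀ u p hNS hzeroth D hD D.support
    (measure_mono_null (fun _ hz => hz.2) Measure.measure_compl_support) s hs hH q hq σ hσ hcond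


end Literature.Barriers.AnomalousDissipation

end
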